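import Summits.ResolutionOfSingularities.ResolutionOfSingularities.Theorems.MarkedTransferCampaignG1PnegaInterface
import HarnessLib

/-!
# [OURS · L1 G1] The `℘nega` INTERFACE, v0.2 — THE CHECKLIST OF RECORD `Campaign.PnegaInterfaceV2` (res-D-plan-1's corrections
# C1/C2 of 2026-08-27T01:12:30Z to the v0 structure of `MarkedTransferCampaignG1PnegaInterface.lean` p480820; statements
# byte-for-byte `D/res-D-plan-1/PnegaInterface.v02.draft.lean` bcfd871d69b40390; carried summit-side by the typer of record res-L1-type-o2)

Why a second file: the gate's append-only rule for `Theorems/` («deprecate, don't mutate») forbids changing the v0 decls of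
p480820 in place, and one file may not exceed 400 lines; so v0 stays (DEPRECATED, docstring-marked) and the corrected checklist
lives here under NEW names. Everything in the v0 file's header (LADDER context, director-resolution RULINGS 2026-08-27T00:20:08Z (c) /
00:40:38Z / 00:58:10Z (1), roles: res-D-plan-1 = field-list authority, res-adj-1 + res-plan-2 = scorers, o2 = Lean typer; host
`--supports stmt-ResolutionOfSingularities-15522`; FIELD ↔ TABLE MAP F1–F10 / O1–O4 with page locators) applies verbatim and is
not repeated. Reused from the v0 file (imported, not restated): `Campaign.PnegaProvenance` (provenance slots, unchanged in v0.2),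
`Campaign.PnegaInterface.negaBl` (coercion of an ideal family into the `Bl(Z)` slot), `Campaign.PnegaInterface.TransformLawSheaf`
(+ anchor; F1 at sheaf level, unchanged). §2 (rev 2.1, APPEND-ONLY over p482012) carries res-D-plan-1's rev-2 addendum
(`G1PnegaInterfaceRev2.addendum.lean` 1a2b4ddbfcd204fa, their `PnegaInterfaceA` = this file's `PnegaInterfaceV2` statement for
statement): `PnegaInterface.normDemand_vacuous` (kernel certificate that the v0 F6d is vacuous), `PnegaInterface.NormDemandPow`,
`PnegaInterface.toV2` (the v0 structure is the `O`-stable special case; every V2 field proved from the v0 field), `toV2_oStable`,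
`toV2_normDemand_iff`, `PnegaInterfaceV2.tailsNonDegenerate_v0_iff`.

THE TWO CORRECTIONS (table writer res-D-plan-1, STATUS 2026-08-27T01:12:30Z; delta note `D/res-D-plan-1/PNEGA-INTERFACE-v0.2-delta.md`
078a2d452f798cf6): (C1, design) the data field `tilde` is valued in `AddSubgroup B`, NOT `Ideal B` — `O`-stability is the SCORED
predicate `OStable` (F6c), because (i) the squeeze theorem `Proofs/S14LocalGlobal/Thm14p11R2b.lean ::
pnega_eq_bot_of_Thm14_11_R2_glued_of_graded_ideal` takes `O`-stability as its hypothesis `hO` (with F6d + F7b no graded candidate can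
have it), (ii) the §13 carriers are `S11CoordFree.BlSub O p ℓ` = `ρ^ℓ(O)`-submodules, (iii) the live candidates are not `O`-modules
degree-wise (W1.3 R-flat tails = `ρ^e(O)`-modules, W1.4 pieces = `S`-modules) — an `Ideal`-valued field excludes BY TYPE what the
instrument must score; all fields are restated pointwise / as inclusions of sets. (C2, mandatory) `NormDemand` v0 was VACUOUS
(`Ideal.span (range (·^(p^e)))` contains `1 = 1^(p^e)`); now: every element of a negative piece IS a `p^e`-th power (the printed
«norm of every `n ∈ ℘nega` lies in `ρ^e(O)`», Th 14.11 R2 p.72, degree by degree; = the kernel's `fnorm pnega ≤ rhoPowSpan e` under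
`CharP`, `e ≤ ℓ`, gradedness — `Thm14p11R2.lean :: fnorm_pnega_le_rhoPowSpan_of_Thm14_11_R2_glued`).

HONEST FRAMING. Nothing here is a statement of H. Hironaka's manuscript *Resolution of singularities in positive
characteristics* (2017-03-23, [Hironaka2017], lit key `paper:url-3343fd9e678b`): every printed item named below is a
CANDIDATE [claim: Hironaka2017, status: under-review] and enters only as the SHAPE of a property a replacement must have; no
field is asserted for any candidate (NOT for the printed Def 5.1 either, recorded as the value `PnegaInterfaceV2.printedTilde`:
res-adj-1's seed has F1 ✗, F5 ✗, F7 ✗ by landed theorems). AI typing is weaker than expert review; nothing here is progress on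
resolution of singularities in positive characteristic; no claim beyond the kernel.
-/

noncomputable section

set_option linter.dupNamespace false -- mandated namespace of this single-conjunct summit

namespace Summit.ResolutionOfSingularities.ResolutionOfSingularities.Theorems.Campaign

open Literature.AlgebraicGeometry.Resolution
open Literature.AlgebraicGeometry.Hironaka2017
open Literature.AlgebraicGeometry.Hironaka2017.S11CoordFree (BlSub)

universe u v

/-! ## §1 The structure (v0.2) -/

/-- [OURS · L1 G1 ℘nega-INTERFACE — THE CHECKLIST, v0.2] replaces the role of «what §§6–7 and §§13–16 consume of
`℘̃(E,·) / ℘nega(E,−a)`» (director-resolution 2026-08-27T00:20:08Z (c)): a uniform candidate `tilde B P : ℤ → AddSubgroup B`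
for «`i ↦ ℘̃(E,i)`» given the characteristic-algebra filtration `P j = ℘(E,j)` of a `K`-algebra `B` (row 003/008
convention; ADDITIVE SUBGROUPS since v0.2 (C1), module structures are scored via `OStable`), together with the properties
downstream consumers bind (table PNEGA-INTERFACE-v0.md §1, res-D-plan-1), pointwise / as inclusions of sets:
F2 `pos_eq` (Lem 5.2 OURS / Th 5.11 (ii), p.26, p.29) and `mul_mem` (Lem 5.8 p.28 L8); F8 `antitone` (Lem 5.9 (1),(3) p.28
L18–L26, given `℘` antitone); F3 `diff_mem` (Def 5.1 (36) / Th 5.11: `Diff^{(μ)}℘̃(E,i) ⊂ ℘̃(E,i−μ)`, given the Th 4.1-shape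
Diff-stability of `℘` as the landed S05/S06 proofs bind it); F5 `mem_iff46` (Th 6.3 Eq. (46) p.30 L22–L24, at an element
`g ∈ ℘(E,q)` satisfying the unit clause of U27L24 «`Diff^{(kq)}(g^k) = O`», for `f ≠ 0`); F9 `root_closed` (U54L42 p.54 /
Th 9.18: `a^p ∈ ℘̃ ⇒ a ∈ ℘̃`, degree convention `p·i ↦ i` — TO BE CONFIRMED by res-adj-1); F7 `neg_proper` (Def 5.1 p.25
l.42–44 with Rem 5.4 p.26, (110) p.69, Th 15.9 p.79: at a non-trivial filtration with a (37)-type element the negative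
pieces are proper ideals — the field the printed Def. 5.1 FAILS, `Proofs/S06BaseHike/Thm6p3.lean ::
pTilde_nonpos_eq_top_of_U27L24`); F1 `transform_mem`/`transform_le` (Th 7.8 Eq. (59) p.37 L8–L17 in one chart, as two
inclusions: `x^a·φ(℘̃(−a)) ⊂ ℘̃′(−a) ⊂ (x^a·φ(℘̃(−a)))B'`); F4 `baseChange_mem`/`baseChange_le` (Th 6.5 Eq. (49) p.32 L4–L17);
F6a `neg_le_sing` (§13.1 p.67 L15, Def 13.2: `℘nega ⊂ I(Sing)Bl(Z)`, binder `hN` of `Def13p2Carrier.lean`). `p` = the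
characteristic (a parameter; no `CharP` assumed). A SCORING ROW for a
candidate is, per field, a kernel proof of the field or of its negation at the candidate's `tilde`; NOTHING is asserted
here for any candidate. NOT a statement of the manuscript. VACUITY: no inhabitant is claimed; the printed candidate
`printedTilde` is known NOT to inhabit it (F1 ✗ c03 3123ccc33b217d44 / p470685, F5 ✗ `not_Thm6_3_affineLineCompletion`,
F7 ✗ R01). [folklore] -/
structure PnegaInterfaceV2 (K : Type u) [CommRing K] (p : ℕ) (prov : PnegaProvenance.{u, v} K) :
    Type (max u (v + 1)) where
  /-- the candidate: `tilde B P i` = «℘̃(E,i)» computed in the `K`-algebra `B` from `P j = ℘(E,j)`; an ADDITIVE SUBGROUP of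
  `B` in each degree (v0.2 (C1): module structure over `O` / `ρ^e(O)` / a subring `S` is SCORED — `OStable` — not typed;
  O1 well-definedness and O3 sheaf/stalk/sections compatibility are obligations ON this datum, table §1 O1–O4) -/
  tilde : ∀ {B : Type v} [CommRing B] [Algebra K B], (ℕ → Ideal B) → ℤ → AddSubgroup B
  /-- F2 / O4 — positive part untouched, `℘̃(E,i) = ℘(E,i)` for `i > 0` (Lem 5.2 p.26 L4 in the OURS `_le/_dvd` shapes
  row 008c p475862, Th 5.11 (ii) p.29; the printed `⊇` for `m ∤ i` is DEAD — R87, `Proofs/S05NegativePart/Lem5p2Countermodel.lean`);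
  abstracts binders `Lem5_2 mCond p f E m` of `…_ours_ctx_of` (Lem59d/Eq41/Rem5p10c) -/
  pos_eq : ∀ {B : Type v} [CommRing B] [Algebra K B] (P : ℕ → Ideal B) (i : ℕ), 0 < i →
    tilde P (i : ℤ) = (P i).toAddSubgroup
  /-- F2 — product rule, Lem 5.8 p.28 L7–L8 / Eq (42) L10–L24 (row 036 `Lem5_8`; pointwise; at the printed candidate this
  field IS `Lem5_8 K P m`, `printedTilde_mul_mem_iff`); abstracts binders `Lem5_8` / `Lem5_8_ctx` of `Rem5_10_negaClosed_of`,
  `Thm5_11_R2_of`, and `hgraded` of `Thm6_3_2_ours_instPTilde_of` / `eq46_of_mem_pTilde` (p477359); consumers Lem 7.10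
  (R57), Th 7.11 (R56/R58) -/
  mul_mem : ∀ {B : Type v} [CommRing B] [Algebra K B] (P : ℕ → Ideal B) (i j : ℤ) (a b : B),
    a ∈ tilde P i → b ∈ tilde P j → a * b ∈ tilde P (i + j)
  /-- F8 — antitone in the degree, given `℘` antitone: Lem 5.9 (1),(3) p.28 L18–L26 (row 036 `Lem5_9_1..4`), behind it
  Lem 5.6 / Eq (38) p.27 L5–L24 (R37) and Rem 5.5 / U28L5 p.26–27 (O1); abstracts binders `∀ a>0, Monotone (d ↦ DD K P m a d)`
  of `Lem5_9_*_of`, `hanti` of `Eq49_of_antitone` / `Thm6_3_2_ours_instPTilde_of`; for the printed candidate these are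
  PROVED and are the collapse engine (`DD_eq_top_of_clause'`, `pTilde_nonpos_eq_top_of_U27L24`) -/
  antitone : ∀ {B : Type v} [CommRing B] [Algebra K B] (P : ℕ → Ideal B),
    (∀ i j : ℕ, i ≤ j → P j ≤ P i) → Antitone (tilde P)
  /-- F3 — Diff-stability, POINTWISE for every differential operator of order `≤ μ` (tree `Resolution.IsDiffOpLE`), given the
  Th 4.1-shape Diff-stability of `℘` as the landed S05/S06 proofs bind it: Def 5.1 (36)–(37) p.25–26, Th 5.11 p.29, Th 6.4
  p.31 L51–L56 (row 038a `IsDiffClosed`), used p.68 L19–L20 (Th 14.1 proof), Rem 11.4 p.62, U54L42 p.54; abstracts binders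
  `hdiff : ∀ a μ, μ<a → diffIdeal K μ (P a) ≤ P (a−μ)` of `pTildeNeg_le_of_diffStable`, `pTilde_le_of_diffStable`, the slot
  hypotheses `boxminus g a ⊆ pTilde` (S09, 17 thms) and `Rem11_4_of_absorbs`; for the printed candidate CONTENT-FREE:R01
  (`diffClosedAll_of_collapse`, res-adj-1 R74) -/
  diff_mem : ∀ {B : Type v} [CommRing B] [Algebra K B] (P : ℕ → Ideal B),
    (∀ a μ : ℕ, μ < a → diffIdeal K μ (P a) ≤ P (a - μ)) →
      ∀ (μ : ℕ) (D : B →ₗ[K] B), IsDiffOpLE K μ D → ∀ (i : ℤ) (f : B), f ∈ tilde P i → D f ∈ tilde P (i - μ)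
  /-- F5 — membership criterion of Eq. (46)-shape at a (37)-element `g ∈ ℘(E,q)` entering through the U27L24 unit
  clause «`Diff^{(kq)}(g^k) = O`»: Th 6.3 p.30 L21–L26 (row 010 `Eq46`, `Thm6_3_1`, `Thm6_3_atM`; R03), invoked in Th 7.11
  (2)'s proof p.38 L30; abstracts binders `f ∈ pTilde K P m (−a)` of `eq46_of_mem_pTilde`, `Thm6_3_atM` of
  `pTilde_nonpos_eq_top_of_Thm6_3_atM`, `Thm6_1` / `Thm6_11` of S06/S09; the printed candidate FAILS it
  (`Proofs/S06BaseHike/Thm6p3Negative.lean :: not_Thm6_3_affineLineCompletion`, `not_Thm6_3_atM_affineLineCompletion`) -/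
  mem_iff46 : ∀ {B : Type v} [CommRing B] [Algebra K B] (P : ℕ → Ideal B) (q : ℕ) (g : B), 0 < q → g ∈ P q →
    (∀ k : ℕ, 0 < k → diffIdeal K (k * q) (Ideal.span {g ^ k}) = ⊤) →
      ∀ (a : ℤ) (f : B), f ≠ 0 →
        (f ∈ tilde P (-a) ↔
          ∃ ℓ₀ : ℕ, ∀ ℓ : ℕ, ℓ₀ ≤ ℓ → a ≤ (q * p ^ ℓ : ℕ) ∧ g ^ p ^ ℓ * f ∈ P (Int.toNat ((q * p ^ ℓ : ℕ) - a)))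
  /-- F9 — `p`-th-root closure `a^p ∈ ℘̃ ⇒ a ∈ ℘̃` (U54L42 p.54, Th 9.18 p.58; degree convention `p·i ↦ i`, v0 — TO BE
  CONFIRMED by res-adj-1); abstracts the slot binder `∀ a, a^p ∈ pTilde → a ∈ pTilde` of `PTildeChainClosure_of_carriers` /
  `Thm9_18_1_of_closure` (p475661) -/
  root_closed : ∀ {B : Type v} [CommRing B] [Algebra K B] (P : ℕ → Ideal B) (b : B) (i : ℤ),
    b ^ p ∈ tilde P (p * i) → b ∈ tilde P i
  /-- F7b — non-degeneracy: at a proper filtration admitting a (37)-type element the negative pieces are PROPER (Def 5.1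
  p.25 l.26, l.42–44; (37) p.26; Rem 5.4 p.26 (R02); consumers (110) p.69 L29–L31, Th 15.9 p.79 L16–L17 (R35), U86L16 p.86);
  abstracts the binders `pnega ≠ ⊥` / `pnega ξ ≠ ⊥` of `Thm14p11R2b/c` and NEGATES the collapse binders
  `∀ a : ℕ, pTildeNeg K P m a = ⊤` of `Lem7_10_nonneg_of` / `Thm7_11_1_of` / `memPTildeBl_iff_pos_of`; the printed candidate
  FAILS it — R01: `Proofs/S06BaseHike/Thm6p3.lean :: pTilde_nonpos_eq_top_of_U27L24`, `Proofs/S16Proof/U86L16.lean ::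
  Def5_1_mCond_false`, res-adj-1 kernels 7819efe8c69f86b5 / 2226ae5d9afb38c8 -/
  neg_proper : ∀ {B : Type v} [CommRing B] [Algebra K B] (P : ℕ → Ideal B) (q : ℕ) (g : B), 0 < q → g ∈ P q →
    (∀ k : ℕ, 0 < k → diffIdeal K (k * q) (Ideal.span {g ^ k}) = ⊤) → P q ≠ ⊤ →
      ∀ a : ℕ, 0 < a → tilde P (-(a : ℤ)) ≠ ⊤
  /-- F1 — transform law of Eq. (59)-shape in one chart of a permissible blow-up, degrees `−a < 0`, as the two inclusions
  «`x^a·φ(℘̃(−a)) ⊂ ℘̃′(−a) ⊂ (x^a·φ(℘̃(−a)))B'`» (equality of `B'`-modules when the candidate is `O`-stable): Th 7.8 / Eq (59)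
  p.37 L8–L17, chain (60) p.37 L22–L28 (row 013 `Thm7_8`, `Thm7_8At`, `Eq59`, `Eq59At`, `lsbExcPow`; `Eq60` R013c); abstracts
  the binders of the TYPED consumers `S07Permissible.R042dThm712` (Th 7.12 p.39, R34), `S16Proof.R097cLem1611Proof` (Lem 16.11
  p.86, R92), `S16Proof.R095aEq130` (Lem 16.7/16.8 (130) p.85) — no landed `_of` binds `Eq59` yet (table §3); sheaf-level
  companion `PnegaInterface.TransformLawSheaf` (§3) binds row 013's actual `Thm7_8Setting`; the printed candidate FAILS it —
  R04(a) evidence 9b1a6c8474bba996 (res-adj-1 2026-08-26T23:59:34Z; inhabitant ff8896f827228a38 entered 01:10:58Z) and,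
  for the sandwich V1, c03 3123ccc33b217d44 / s12 p470685 (order-zero summand, every operator base) -/
  transform_mem : ∀ {B B' : Type v} [CommRing B] [CommRing B'] [Algebra K B] [Algebra K B']
    (φ : B →ₐ[K] B') (x : B') (P : ℕ → Ideal B) (P' : ℕ → Ideal B'), prov.IsChart φ x P P' →
      ∀ (a : ℕ) (f : B), f ∈ tilde P (-(a : ℤ)) → x ^ a * φ f ∈ tilde P' (-(a : ℤ))
  /-- F1, second inclusion: `℘̃′(−a) ⊂ (x^a·φ(℘̃(−a)))B'`. -/
  transform_le : ∀ {B B' : Type v} [CommRing B] [CommRing B'] [Algebra K B] [Algebra K B']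
    (φ : B →ₐ[K] B') (x : B') (P : ℕ → Ideal B) (P' : ℕ → Ideal B'), prov.IsChart φ x P P' →
      ∀ a : ℕ, (tilde P' (-(a : ℤ)) : Set B') ⊆
        (Ideal.span ((fun f : B => x ^ a * φ f) '' (tilde P (-(a : ℤ)) : Set B)) : Set B')
  /-- F4 — completion / flat base change of Eq. (49)-shape, as the two inclusions «`φ(℘̃(i)) ⊂ ℘̃̂(i) ⊂ φ(℘̃(i))B'`»: Th 6.5 /
  Eq (49) p.32 L4–L17, Th 6.6 (rows 038/039; R82 «display direction vs proof direction»); abstracts `Eq49`/`Thm6_5_concl`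
  (`Eq49_of_antitone`, `Thm6_5_concl_of_antitone` bind only `hanti`; `Thm6_5_conv_inst_iff_collapse` shows the converse
  inclusion ⟺ collapse) — CONTENT-FREE:R01 for the printed candidate, a genuine flat-base-change requirement for a
  non-degenerate one -/
  baseChange_mem : ∀ {B B' : Type v} [CommRing B] [CommRing B'] [Algebra K B] [Algebra K B']
    (φ : B →ₐ[K] B') (P : ℕ → Ideal B) (P' : ℕ → Ideal B'), prov.IsCompletion φ P P' →
      ∀ (i : ℤ) (f : B), f ∈ tilde P i → φ f ∈ tilde P' i
  /-- F4, second inclusion: `℘̃̂(i) ⊂ φ(℘̃(i))B'`. -/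
  baseChange_le : ∀ {B B' : Type v} [CommRing B] [CommRing B'] [Algebra K B] [Algebra K B']
    (φ : B →ₐ[K] B') (P : ℕ → Ideal B) (P' : ℕ → Ideal B'), prov.IsCompletion φ P P' →
      ∀ i : ℤ, (tilde P' i : Set B') ⊆ (Ideal.span (φ '' (tilde P i : Set B)) : Set B')
  /-- F6a — placement inside the ideal of the singular locus, `℘nega(E,−a) ⊂ I(Sing E)` for `a > 0` (§13.1 p.67 L15,
  Def 13.2 (105)–(106) p.67 L16–L22; R08(α)); abstracts the binder `hN : pnega ≤ span{C a·T d : a ∈ I}` of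
  `Def13p2Carrier.lean :: TFlat_subset_ideal`, `Cot_subset_radical`, `Cot_ne_top_of_subset` (p475363); the other §13
  demands are scored through `NormDemand` (F6d), `OStable` (F6c) and `TailsNonDegenerate` (§3); the printed collapsed
  candidate is «degree-full» and FAILS them (`TFlat_eq_top_of_degree_full`, `Cot_eq_top_of_degree_full`; R08(α)
  a12a48e4e4816da4) -/
  neg_le_sing : ∀ {B : Type v} [CommRing B] [Algebra K B] (P : ℕ → Ideal B) (I : Ideal B),
    prov.IsSingIdeal P I → ∀ a : ℕ, 0 < a → tilde P (-(a : ℤ)) ≤ I.toAddSubgroup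


namespace PnegaInterfaceV2

variable {K : Type u} [CommRing K] {p : ℕ} {prov : PnegaProvenance.{u, v} K}

/-- [OURS · L1 G1 ℘nega-INTERFACE · F6d] replaces the role of the Th. 14.11-R2 demand (p.72; kernel necessary condition
res-087 13856211724f133b; landed `Proofs/S14LocalGlobal/Thm14p11R2*.lean :: fnorm_pnega_le_rhoPowSpan_of_Thm14_11_R2_glued`):
every element of every negative piece IS a `p^e`-th power (v0.2 (C2): the v0 rendering `≤ Ideal.span (range (·^(p^e)))`
was VACUOUS — that span contains `1`; the set inclusion is the kernel's `fnorm ℘nega ≤ rhoPowSpan e` read degree by degree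
on a graded candidate, under `CharP B p`, `e ≤ ℓ`). Kept OUT of the structure: for graded `O`-stable candidates it forces
`℘nega = ⊥` (`pnega_eq_bot_of_Thm14_11_R2_glued_of_graded_ideal`), i.e. it is scored AGAINST F7 `neg_proper` (jointly with
`OStable`), never assumed with it. NOT a statement of the manuscript. VACUITY: trivial for a candidate `⊥` in negative
degrees (the W1.3 bypass), which then fails F7. [folklore] -/
def NormDemand (I : PnegaInterfaceV2 K p prov) (e : ℕ) : Prop :=
  ∀ {B : Type v} [CommRing B] [Algebra K B] (P : ℕ → Ideal B) (a : ℕ), 0 < a →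
    (I.tilde P (-(a : ℤ)) : Set B) ⊆ Set.range fun b : B => b ^ p ^ e

/-- [OURS · L1 G1 ℘nega-INTERFACE · F6c] replaces the role of the `O`-STABILITY of the candidate (Def 5.1 p.25 L33
«O_Z-submodule»; the hypothesis `hO` of `Thm14p11R2b :: pnega_eq_bot_of_Thm14_11_R2_glued_of_graded_ideal`). A SCORED
property since v0.2 (C1), never typed into the data field: `OStable ∧ NormDemand ∧ F7b` is the combination the kernel
refutes for graded candidates. NOT a statement of the manuscript. VACUITY: automatic for ideal-valued candidates
(`printedTilde_oStable`); fails for genuinely `ρ^e(O)`-module candidates. [folklore] -/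
def OStable (I : PnegaInterfaceV2 K p prov) : Prop :=
  ∀ {B : Type v} [CommRing B] [Algebra K B] (P : ℕ → Ideal B) (i : ℤ) (r x : B),
    x ∈ I.tilde P i → r * x ∈ I.tilde P i

/-- [OURS · L1 G1 ℘nega-INTERFACE — the printed Def. 5.1 as a candidate VALUE of the data field] row 008a's
`pTilde K P m` (parameter `m`): recorded so that «V1» can be scored field by field — it is NOT claimed to satisfy the
structure (res-adj-1's seed: F1 ✗, F5 ✗, F7 ✗ by landed theorems). NOT a statement of the manuscript. [folklore] -/
def printedTilde (K : Type u) [CommRing K] (m : ℕ) {B : Type v} [CommRing B] [Algebra K B]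
    (P : ℕ → Ideal B) (i : ℤ) : AddSubgroup B :=
  (S05NegativePart.pTilde K P m i).toAddSubgroup

/-- Sanity (definitional): the printed candidate's negative piece is row 008a's `pNega`. [folklore] -/
theorem printedTilde_neg (K : Type u) [CommRing K] (m : ℕ) {B : Type v} [CommRing B] [Algebra K B]
    (P : ℕ → Ideal B) (a : ℕ) :
    printedTilde K m P (-(a : ℤ)) = (S05NegativePart.pNega K P m a).toAddSubgroup := by
  simp [printedTilde, S05NegativePart.pTilde, S05NegativePart.pNega]

/-- Anchor: the F2 field `mul_mem` AT the printed candidate, ring by ring, IS row 036's typed `Lem5_8 K P m` (Lem 5.8 p.28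
L7–L8 as typed; ideal products read pointwise, `Ideal.mul_le`) — so V1's F2 cell cites the typed decl by name. No claim
that it holds. [folklore] -/
theorem printedTilde_mul_mem_iff (K : Type u) [CommRing K] (m : ℕ) {B : Type v} [CommRing B] [Algebra K B]
    (P : ℕ → Ideal B) :
    (∀ (i j : ℤ) (a b : B), a ∈ printedTilde K m P i → b ∈ printedTilde K m P j →
        a * b ∈ printedTilde K m P (i + j)) ↔ S05NegativePart.Lem5_8 K P m := by
  simp only [printedTilde, Submodule.mem_toAddSubgroup, S05NegativePart.Lem5_8, Ideal.mul_le]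
  constructor
  · intro h i j a ha b hb; exact h i j a b ha hb
  · intro h i j a b ha hb; exact h i j a ha b hb

/-- Anchor: the printed candidate is `O`-stable in the sense of F6c (it is ideal-valued), ring by ring. [folklore] -/
theorem printedTilde_oStable (K : Type u) [CommRing K] (m : ℕ) {B : Type v} [CommRing B] [Algebra K B]
    (P : ℕ → Ideal B) (i : ℤ) (r x : B) (hx : x ∈ printedTilde K m P i) : r * x ∈ printedTilde K m P i := by
  simp only [printedTilde, Submodule.mem_toAddSubgroup] at hx ⊢
  exact Ideal.mul_mem_left _ r hx


section Tails

variable {O : Type v} [CommRing O] {p : ℕ} [Fact p.Prime] [CharP O p]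

/-- [OURS · L1 G1 ℘nega-INTERFACE · F6 (R08(α) form, res-adj-1 seed 2026-08-27T00:34:09Z: «𝔗♭/Cot(Ě) ≠ O_ξ at ξ ∈
Sing»)] replaces the role of the NON-DEGENERACY of Def 13.2's objects (p.67 L16–L22: (105) `𝔗♯(Ě) = (𝔏_0(∞) ∩ ℘posi) +
℘nega`, `𝔗♭(Ě) = ∥𝔗♯(Ě)∥`, (106) `Cot(Ě) = (𝔗♭ ∩ ρ^e(O))^{1/q}`; feeding Th 14.1 (4) p.68 L16, (109) p.69, Th 14.6 p.70,
Th 14.11, Lem 16.7/16.8 (130) p.85; table row F6) for a stalk-level family `N : ℤ → Ideal O` (a candidate `I` evaluated at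
one ring) PARAMETRISED BY THE SLOT VALUE `pnega : BlSub O p ℓ` itself (row 015's type, v0.2 per res-D-plan-1: so that every
slot-filling candidate — ideal-valued via `negaBl`/`TailsNonDegenerateOfFamily`, `ρ^e(O)`-module-valued directly — is scorable):
the flat tails module and the cotangent GL-module are NOT everything. `L0inf` («𝔏_0(∞)»), `pposi`, `ℓ`, `e` stay parameters
exactly as in row 015. Outside the structure because it needs `CharP O p` and the §13 parameters. NOT a statement of the
manuscript. VACUITY: for the printed collapsed candidate it FAILS (`Def13p2Carrier.lean :: TFlat_eq_top_of_degree_full`,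
`Cot_eq_top_of_degree_full`); for `L0inf = ⊤ = pposi` it fails trivially — instantiate at diagram (104)'s modules. [folklore] -/
def TailsNonDegenerate (ℓ e : ℕ) (L0inf pposi pnega : BlSub O p ℓ) : Prop :=
  S13GLUEDDiagram.TFlat L0inf pposi pnega ≠ ⊤ ∧ S13GLUEDDiagram.Cot e L0inf pposi pnega ≠ ⊤

/-- The ideal-family instance of `TailsNonDegenerate`: the slot filled by `negaBl ℓ N` (coercion for ideal-valued
candidates; `ρ^e(O)`-module candidates such as the W1.3 R-flat tails supply their own `pnega : BlSub O p ℓ`). [folklore] -/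
abbrev TailsNonDegenerateOfFamily (ℓ e : ℕ) (L0inf pposi : BlSub O p ℓ) (N : ℤ → Ideal O) : Prop :=
  TailsNonDegenerate ℓ e L0inf pposi (PnegaInterface.negaBl ℓ N)


end Tails

end PnegaInterfaceV2


/-! ## §2 Bridge from v0 (res-D-plan-1's rev-2 addendum `D/res-D-plan-1/G1PnegaInterfaceRev2.addendum.lean` 1a2b4ddbfcd204fa,
carried with `PnegaInterfaceA ↦ PnegaInterfaceV2`; proofs theirs): the v0 `Ideal`-valued structure is the `O`-stable special case -/

namespace PnegaInterface

variable {K : Type u} [CommRing K] {p : ℕ} {prov : PnegaProvenance.{u, v} K}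

/-- KERNEL CERTIFICATE (negative side, typing-level record; res-D-plan-1 rev 2): the v0 F6d rendering
`PnegaInterface.NormDemand` (p480820, DEPRECATED) holds for EVERY candidate — `Ideal.span (range (·^(p^e)))` contains
`1 = 1^(p^e)` — so it must never be cited as the Th 14.11-R2 demand; cite `PnegaInterfaceV2.NormDemand` / `NormDemandPow`. [folklore] -/
theorem normDemand_vacuous (I : PnegaInterface K p prov) (e : ℕ) : I.NormDemand e := by
  intro B _ _ P a _
  have h1 : (1 : B) ∈ Ideal.span (Set.range fun b : B => b ^ p ^ e) := Ideal.subset_span ⟨1, one_pow _⟩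
  rw [(Ideal.eq_top_iff_one _).mpr h1]
  exact le_top

/-- [OURS · L1 G1 ℘nega-INTERFACE · F6d corrected (C2) for the v0 `Ideal`-valued structure] every element of `℘̃(−a)`,
`a > 0`, is a `p^e`-th power (res-D-plan-1 rev 2 `NormDemandPow`). NOT a statement of the manuscript. [folklore] -/
def NormDemandPow (I : PnegaInterface K p prov) (e : ℕ) : Prop :=
  ∀ {B : Type v} [CommRing B] [Algebra K B] (P : ℕ → Ideal B) (a : ℕ), 0 < a →
    ((I.tilde P (-(a : ℤ)) : Ideal B) : Set B) ⊆ Set.range fun b : B => b ^ p ^ e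

/-- The v0 `Ideal`-valued structure is the `O`-stable special case of `PnegaInterfaceV2`: forget the module structure.
Every V2 field follows from the corresponding v0 field (res-D-plan-1 rev 2 `toA`, renamed). So `Campaign.PnegaInterface`
(DEPRECATED as the scoring type) remains citable for ideal-valued candidates via `toV2`. [folklore] -/
def toV2 (I : PnegaInterface K p prov) : PnegaInterfaceV2 K p prov where
  tilde := fun P i => (I.tilde P i).toAddSubgroup
  pos_eq := fun P i hi => by rw [I.pos_eq P i hi]
  mul_mem := fun P i j a b ha hb => I.mul_le P i j (Ideal.mul_mem_mul ha hb)
  antitone := fun P hP _ _ hij _ hx => I.antitone P hP hij hx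
  diff_mem := fun P hP μ D hD i f hf => I.diff_le P hP μ i (apply_mem_diffIdeal K hD hf)
  mem_iff46 := fun P q g hq hg hunit a f hf => I.mem_iff46 P q g hq hg hunit a f hf
  root_closed := fun P b i h => I.root_closed P b i h
  neg_proper := fun P q g hq hg hunit hPq a ha h =>
    I.neg_proper P q g hq hg hunit hPq a ha (by
      rw [eq_top_iff]
      intro y _
      have hy : y ∈ (⊤ : AddSubgroup _) := AddSubgroup.mem_top y
      rw [← h] at hy
      exact hy)
  transform_mem := fun φ x P P' hc a f hf => by
    show x ^ a * φ f ∈ I.tilde P' (-(a : ℤ))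
    rw [I.transform φ x P P' hc a]
    exact Ideal.mul_mem_mul (Ideal.mem_span_singleton_self _) (Ideal.mem_map_of_mem φ hf)
  transform_le := fun φ x P P' hc a y hy => by
    have hy' : y ∈ I.tilde P' (-(a : ℤ)) := hy
    have heq : Ideal.span {x ^ a} * Ideal.map φ (I.tilde P (-(a : ℤ))) =
        Ideal.span ((fun f : _ => x ^ a * φ f) '' (I.tilde P (-(a : ℤ)) : Set _)) := by
      rw [Ideal.map, Ideal.span_mul_span', Set.singleton_mul, Set.image_image]
    rw [I.transform φ x P P' hc a, heq] at hy'
    exact hy'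
  baseChange_mem := fun φ P P' hc i f hf => by
    show φ f ∈ I.tilde P' i
    rw [I.baseChange φ P P' hc i]
    exact Ideal.mem_map_of_mem φ hf
  baseChange_le := fun φ P P' hc i y hy => by
    have hy' : y ∈ I.tilde P' i := hy
    rw [I.baseChange φ P P' hc i] at hy'
    exact hy'
  neg_le_sing := fun P I₀ hI a ha _ hx => I.neg_le_sing P I₀ hI a ha hx

/-- … and it is automatically `O`-stable (F6c) — which is why the `Ideal`-valued rendering cannot be the scoring type:
`OStable ∧ NormDemand ∧` (Th 14.11 R2 on the glued `T♯`) squeeze `℘nega` to `⊥` (`Thm14p11R2b/c`). [folklore] -/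
theorem toV2_oStable (I : PnegaInterface K p prov) : I.toV2.OStable :=
  fun P i r _ hx => Ideal.mul_mem_left (I.tilde P i) r hx

/-- Unfolding (by `Iff.rfl`): the V2 F6d demand on the forgetful image is the corrected `NormDemandPow`. [folklore] -/
theorem toV2_normDemand_iff (I : PnegaInterface K p prov) (e : ℕ) : I.toV2.NormDemand e ↔ I.NormDemandPow e :=
  Iff.rfl

end PnegaInterface

namespace PnegaInterfaceV2

section TailsBridge

variable {O : Type v} [CommRing O] {p : ℕ} [Fact p.Prime] [CharP O p]

/-- Unfolding (by `Iff.rfl`): the v0 family form `PnegaInterface.TailsNonDegenerate` IS the slot form at `pnega := negaBl ℓ N`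
(res-D-plan-1 rev 2 `tailsNonDegenerate_iff`). [folklore] -/
theorem tailsNonDegenerate_v0_iff (ℓ e : ℕ) (L0inf pposi : BlSub O p ℓ) (N : ℤ → Ideal O) :
    PnegaInterface.TailsNonDegenerate ℓ e L0inf pposi N ↔
      TailsNonDegenerate ℓ e L0inf pposi (PnegaInterface.negaBl ℓ N) :=
  Iff.rfl

end TailsBridge

end PnegaInterfaceV2

end Summit.ResolutionOfSingularities.ResolutionOfSingularities.Theorems.Campaign

end
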